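import Literature.MathematicalPhysics.QuantumLattice.DuhamelTwoPoint

/-!
# Route BalabanIR — crux `BirGroundStateAverageLRO` (item `stmt-HubbardSuperconductivity-2079`), line `Sketch` (softmin-pair-penalty): stub `stub_sectorGibbsLogSum`

The Gibbs / log-sum inequality in a sector (the scalar heart of the second inequality of the
softmin chain of line `Sketch`, "`log Z ≤ -β⟨K⟩ + S`, `S ≤ log dim`" restricted to a sector):
for an idempotent Hermitian `P` and a Hermitian `K`, with `Z = Re tr (P e^{-βK})`,

  `Z · log Z + β · Re tr (P e^{-βK} K) ≤ Z · log (Re tr P)`      (`stub_sectorGibbsLogSum`).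

Proof: in an eigenbasis `K = U diag(λ) U⋆` one has `Z = Σᵢ wᵢ e^{-βλᵢ}` and
`Re tr (P e^{-βK} K) = Σᵢ wᵢ λᵢ e^{-βλᵢ}` with the weights `wᵢ = Re (U⋆ P U)ᵢᵢ ≥ 0`,
`Σᵢ wᵢ = Re tr P` (`U⋆ P U` is again an idempotent Hermitian matrix, so its diagonal entries are
`Σⱼ |(U⋆PU)ᵢⱼ|² ≥ 0`); the claim is then the scalar Gibbs inequality
`Σᵢ aᵢ log (Z wᵢ / (aᵢ W)) ≤ Σᵢ aᵢ (Z wᵢ / (aᵢ W) - 1) = 0` for `aᵢ = wᵢ e^{-βλᵢ}`, `W = Σ wᵢ`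
(`log x ≤ x - 1`). No sign assumption on `β` is needed; `Real.log 0 = 0` covers `Z = 0`.

Sources: the Gibbs variational principle, O. Bratteli, D. W. Robinson, *Operator Algebras and
Quantum Statistical Mechanics* II, Prop. 6.2.22; B. Simon, *The Statistical Mechanics of Lattice
Gases* I (1993), Thm. I.8.5. Folklore; no definition is introduced.
-/

noncomputable section

namespace Summit.HubbardSuperconductivity.HubbardSuperconductivity.Theorems.BirGroundStateAverageLRO.Softmin

open Matrix Finset Literature.MathematicalPhysics.QuantumLattice
open scoped ComplexOrder

variable {n : Type*} [Fintype n] [DecidableEq n]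

/-! ### The scalar Gibbs / log-sum inequality -/

omit [DecidableEq n] in
/-- **Scalar Gibbs inequality** (auxiliary form with named abbreviations): for weights `wᵢ ≥ 0`,
`aᵢ = e^{-βλᵢ} wᵢ`, `Z = Σ aᵢ`, `W = Σ wᵢ` one has `Z log Z + β Σ aᵢ λᵢ ≤ Z log W`
(`Σ aᵢ log (Z wᵢ/(aᵢ W)) ≤ Σ (Z wᵢ/W - aᵢ) = 0` by `log x ≤ x - 1`). [folklore] -/
theorem sectorGibbs_sum_mul_log_le_aux (w lam : n → ℝ) (hw : ∀ i, 0 ≤ w i) (β : ℝ) {a : n → ℝ}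
    (ha : ∀ i, a i = Real.exp (-(β * lam i)) * w i) {Z W : ℝ} (hZ : Z = ∑ i, a i)
    (hW : W = ∑ i, w i) :
    Z * Real.log Z + β * ∑ i, a i * lam i ≤ Z * Real.log W := by
  have ha0 : ∀ i, 0 ≤ a i := fun i => by
    rw [ha i]; exact mul_nonneg (Real.exp_pos _).le (hw i)
  have hZ0 : 0 ≤ Z := by rw [hZ]; exact sum_nonneg fun i _ => ha0 i
  rcases hZ0.eq_or_lt with hZ00 | hZpos
  · -- `Z = 0`: every weight vanishes and both sides are `0`
    have hall : ∀ i, a i = 0 := fun i =>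
      (sum_eq_zero_iff_of_nonneg fun i _ => ha0 i).1 (hZ00.trans hZ).symm i (mem_univ i)
    have hmid : ∑ i, a i * lam i = 0 := sum_eq_zero fun i _ => by rw [hall i, zero_mul]
    rw [← hZ00, hmid]
    simp
  · have hWpos : 0 < W := by
      rw [hW]
      refine (sum_nonneg fun i _ => hw i).lt_of_ne fun hW00 => hZpos.ne' ?_
      have hall : ∀ i, w i = 0 := fun i =>
        (sum_eq_zero_iff_of_nonneg fun i _ => hw i).1 hW00.symm i (mem_univ i)
      rw [hZ]
      exact sum_eq_zero fun i _ => by rw [ha i, hall i, mul_zero]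
    -- `β aᵢ λᵢ = aᵢ log wᵢ - aᵢ log aᵢ`
    have hmid : β * ∑ i, a i * lam i =
        ∑ i, a i * Real.log (w i) - ∑ i, a i * Real.log (a i) := by
      rw [mul_sum, ← sum_sub_distrib]
      refine sum_congr rfl fun i _ => ?_
      rcases (hw i).eq_or_lt with hw0 | hw0
      · have hai : a i = 0 := by rw [ha i, ← hw0, mul_zero]
        rw [hai]
        simp
      · rw [ha i, Real.log_mul (Real.exp_pos _).ne' hw0.ne', Real.log_exp]
        ring
    -- the per-term bound `aᵢ log (Z wᵢ/(aᵢ W)) ≤ Z wᵢ/W - aᵢ`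
    have hkey : ∑ i, (a i * Real.log Z + a i * Real.log (w i) - a i * Real.log (a i) -
        a i * Real.log W) ≤ ∑ i, (Z * w i / W - a i) := by
      refine sum_le_sum fun i _ => ?_
      rcases (hw i).eq_or_lt with hw0 | hw0
      · have hai : a i = 0 := by rw [ha i, ← hw0, mul_zero]
        rw [hai, ← hw0]
        simp
      · have hai : 0 < a i := by rw [ha i]; exact mul_pos (Real.exp_pos _) hw0
        have ht : 0 < Z * w i / (W * a i) := by positivity
        have hlog : Real.log (Z * w i / (W * a i)) =
            Real.log Z + Real.log (w i) - Real.log (a i) - Real.log W := by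
          rw [Real.log_div (by positivity) (by positivity), Real.log_mul hZpos.ne' hw0.ne',
            Real.log_mul hWpos.ne' hai.ne']
          ring
        have h := mul_le_mul_of_nonneg_left (Real.log_le_sub_one_of_pos ht) hai.le
        rw [hlog] at h
        have hane : a i ≠ 0 := hai.ne'
        have hWne : W ≠ 0 := hWpos.ne'
        have heq : a i * (Z * w i / (W * a i) - 1) = Z * w i / W - a i := by
          field_simp
        linarith
    have h1 : ∑ i, a i * Real.log Z = Z * Real.log Z := by rw [← sum_mul, ← hZ]
    have h2 : ∑ i, a i * Real.log W = Z * Real.log W := by rw [← sum_mul, ← hZ]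
    have h3 : ∑ i, Z * w i / W = Z := by
      rw [← sum_div, ← mul_sum, ← hW]
      exact mul_div_cancel_right₀ Z hWpos.ne'
    have h4 : ∑ i, (Z * w i / W - a i) = Z - Z := by rw [sum_sub_distrib, h3, ← hZ]
    rw [sum_sub_distrib, sum_sub_distrib, sum_add_distrib, h1, h2, h4] at hkey
    rw [hmid]
    linarith

omit [DecidableEq n] in
/-- **Scalar Gibbs inequality**: for weights `wᵢ ≥ 0` and levels `λᵢ`,
`Z log Z + β Σᵢ e^{-βλᵢ} λᵢ wᵢ ≤ Z log (Σᵢ wᵢ)` with `Z = Σᵢ e^{-βλᵢ} wᵢ`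
("`log Z ≤ -β⟨λ⟩ + S`, `S ≤ log W`"). [folklore] -/
theorem sectorGibbs_sum_mul_log_le (w lam : n → ℝ) (hw : ∀ i, 0 ≤ w i) (β : ℝ) :
    (∑ i, Real.exp (-(β * lam i)) * w i) * Real.log (∑ i, Real.exp (-(β * lam i)) * w i) +
        β * ∑ i, Real.exp (-(β * lam i)) * lam i * w i ≤
      (∑ i, Real.exp (-(β * lam i)) * w i) * Real.log (∑ i, w i) := by
  have h := sectorGibbs_sum_mul_log_le_aux w lam hw β
    (a := fun i => Real.exp (-(β * lam i)) * w i) (fun _ => rfl) rfl rfl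
  have hmid : ∑ i, Real.exp (-(β * lam i)) * lam i * w i =
      ∑ i, Real.exp (-(β * lam i)) * w i * lam i := sum_congr rfl fun i _ => by ring
  rw [hmid]
  exact h

/-! ### Matrix bookkeeping in an eigenbasis of `K` -/

omit [DecidableEq n] in
/-- The diagonal entries of an idempotent Hermitian matrix have nonnegative real part:
`Qᵢᵢ = (Q²)ᵢᵢ = Σⱼ |Qᵢⱼ|²`. [folklore] -/
theorem sectorGibbs_re_apply_self_nonneg {Q : Matrix n n ℂ} (hQQ : Q * Q = Q)
    (hQh : Q.IsHermitian) (i : n) : 0 ≤ (Q i i).re := by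
  have h : Q i i = ∑ j, Q i j * star (Q i j) := by
    conv_lhs => rw [← hQQ, mul_apply]
    refine sum_congr rfl fun j _ => ?_
    rw [← conjTranspose_apply Q i j, hQh.eq]
  rw [h, Complex.re_sum]
  refine sum_nonneg fun j _ => ?_
  rw [mul_star_eq_normSq_cast, Complex.ofReal_re]
  positivity

/-- Unitary invariance of the trace: `tr (U⋆ P U) = tr P`. [folklore] -/
theorem sectorGibbs_trace_star_mul_mul {U : Matrix n n ℂ} (hU : U ∈ unitary (Matrix n n ℂ))
    (P : Matrix n n ℂ) : (star U * P * U).trace = P.trace := by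
  rw [trace_mul_cycle, Unitary.mul_star_self_of_mem hU, Matrix.one_mul]

/-- `Re tr (P · U diag(d) U⋆) = Σᵢ dᵢ Re (U⋆ P U)ᵢᵢ` for real `d`. [folklore] -/
theorem sectorGibbs_re_trace_mul_conj_diagonal (P U : Matrix n n ℂ) (d : n → ℝ) :
    (P * (U * diagonal (fun i => (d i : ℂ)) * star U)).trace.re =
      ∑ i, d i * ((star U * P * U) i i).re := by
  rw [trace_mul_comm, trace_unitary_conj_mul, trace, Complex.re_sum]
  refine sum_congr rfl fun i _ => ?_
  rw [diag_apply, diagonal_mul, Complex.re_ofReal_mul]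

/-- `Re tr (P · U diag(d) U⋆ · K) = Σᵢ dᵢ lᵢ Re (U⋆ P U)ᵢᵢ` when `U⋆ K U = diag(l)` for a unitary `U`
and real `d`, `l`. [folklore] -/
theorem sectorGibbs_re_trace_mul_conj_diagonal_mul {U : Matrix n n ℂ}
    (hU : U ∈ unitary (Matrix n n ℂ)) (P K : Matrix n n ℂ) (d l : n → ℝ)
    (hK : star U * K * U = diagonal (fun i => (l i : ℂ))) :
    (P * (U * diagonal (fun i => (d i : ℂ)) * star U) * K).trace.re =
      ∑ i, d i * l i * ((star U * P * U) i i).re := by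
  have hcyc : (P * (U * diagonal (fun i => (d i : ℂ)) * star U) * K).trace =
      (diagonal (fun i => (d i : ℂ)) * (star U * (K * P) * U)).trace := by
    calc (P * (U * diagonal (fun i => (d i : ℂ)) * star U) * K).trace
        = ((P * U) * (diagonal (fun i => (d i : ℂ)) * star U * K)).trace := by
          simp only [Matrix.mul_assoc]
      _ = ((diagonal (fun i => (d i : ℂ)) * star U * K) * (P * U)).trace := trace_mul_comm _ _
      _ = _ := by simp only [Matrix.mul_assoc]
  rw [hcyc, star_unitary_mul_mul_mul hU, hK, ← Matrix.mul_assoc, diagonal_mul_diagonal, trace,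
    Complex.re_sum]
  refine sum_congr rfl fun i _ => ?_
  rw [diag_apply, diagonal_mul, ← Complex.ofReal_mul, Complex.re_ofReal_mul]

/-! ### The stub -/

/-- **Gibbs / log-sum inequality in a sector.** For an idempotent Hermitian `P` and a Hermitian
`K`, with `Z = Re tr (P e^{-βK})`: `Z · log Z + β · Re tr (P e^{-βK} K) ≤ Z · log (Re tr P)`.
(In an eigenbasis `K = U diag(λ) U⋆`: `Z = Σᵢ wᵢ e^{-βλᵢ}`, `Re tr (P e^{-βK} K) = Σᵢ wᵢ λᵢ e^{-βλᵢ}`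
with weights `wᵢ = Re (U⋆ P U)ᵢᵢ ≥ 0`, `Σᵢ wᵢ = Re tr P`; then it is the scalar Gibbs inequality
`sectorGibbs_sum_mul_log_le` — "`log Z ≤ -β⟨K⟩ + S`, `S ≤ log dim`".) Gibbs variational principle,
Bratteli–Robinson II Prop. 6.2.22; Simon, *Statistical Mechanics of Lattice Gases* I, Thm. I.8.5.
[folklore] -/
theorem stub_sectorGibbsLogSum (P K : Matrix n n ℂ) (hP : P * P = P) (hPh : P.IsHermitian)
    (hK : K.IsHermitian) (β : ℝ) :
    (P * gibbsWeight β K).trace.re * Real.log ((P * gibbsWeight β K).trace.re) +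
        β * (P * gibbsWeight β K * K).trace.re ≤
      (P * gibbsWeight β K).trace.re * Real.log (P.trace.re) := by
  have hUm : (hK.eigenvectorUnitary : Matrix n n ℂ) ∈ unitary (Matrix n n ℂ) :=
    hK.eigenvectorUnitary.prop
  -- the rotated sector projection `Q = U⋆ P U` is again an idempotent Hermitian matrix
  have hQQ : star (hK.eigenvectorUnitary : Matrix n n ℂ) * P * (hK.eigenvectorUnitary : Matrix n n ℂ) *
      (star (hK.eigenvectorUnitary : Matrix n n ℂ) * P * (hK.eigenvectorUnitary : Matrix n n ℂ)) =
      star (hK.eigenvectorUnitary : Matrix n n ℂ) * P * (hK.eigenvectorUnitary : Matrix n n ℂ) := by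
    rw [← star_unitary_mul_mul_mul hUm, hP]
  have hQh : (star (hK.eigenvectorUnitary : Matrix n n ℂ) * P *
      (hK.eigenvectorUnitary : Matrix n n ℂ)).IsHermitian :=
    isHermitian_conjTranspose_mul_mul _ hPh
  have hw0 : ∀ i, 0 ≤ ((star (hK.eigenvectorUnitary : Matrix n n ℂ) * P *
      (hK.eigenvectorUnitary : Matrix n n ℂ)) i i).re :=
    fun i => sectorGibbs_re_apply_self_nonneg hQQ hQh i
  -- the three traces in the eigenbasis
  have hZ : (P * gibbsWeight β K).trace.re = ∑ i, Real.exp (-(β * hK.eigenvalues i)) *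
      ((star (hK.eigenvectorUnitary : Matrix n n ℂ) * P *
        (hK.eigenvectorUnitary : Matrix n n ℂ)) i i).re := by
    rw [hK.gibbsWeight_eq β]
    exact sectorGibbs_re_trace_mul_conj_diagonal _ _ _
  have hE : (P * gibbsWeight β K * K).trace.re = ∑ i, Real.exp (-(β * hK.eigenvalues i)) *
      hK.eigenvalues i * ((star (hK.eigenvectorUnitary : Matrix n n ℂ) * P *
        (hK.eigenvectorUnitary : Matrix n n ℂ)) i i).re := by
    rw [hK.gibbsWeight_eq β]
    exact sectorGibbs_re_trace_mul_conj_diagonal_mul hUm _ _ _ _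
      hK.star_mul_self_mul_eq_diagonal
  have hW : P.trace.re = ∑ i, ((star (hK.eigenvectorUnitary : Matrix n n ℂ) * P *
      (hK.eigenvectorUnitary : Matrix n n ℂ)) i i).re := by
    rw [← sectorGibbs_trace_star_mul_mul hUm P, trace, Complex.re_sum]
    rfl
  rw [hZ, hE, hW]
  exact sectorGibbs_sum_mul_log_le _ _ hw0 β

end Summit.HubbardSuperconductivity.HubbardSuperconductivity.Theorems.BirGroundStateAverageLRO.Softmin
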